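/-
Copyright: lead seat `ym-line-sll-p1` (prover-ym-line-sll-p1-g0-0), route `SoftLoopLongLag`, crux `ColdBoxSoftLoopLagFloor`
(stmt-QuantumFields-24180; stub E1b `stub_innerDatumCovStabilityG` of `Cruxes/ColdBoxSoftLoopLagFloor/Lines/birth.lean` v7).
-/
import Summits.QuantumFields.YangMills.Theorems.SoftLoopLongLagInductanceSymmetry
import Summits.QuantumFields.YangMills.Theorems.SoftLoopLongLagInductanceBounds
import Summits.QuantumFields.YangMills.Theorems.SoftLoopLongLagFreeMaxwellLagPositivity
import Summits.QuantumFields.YangMills.Theorems.SoftLoopLongLagDirichletLoopInductance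

/-!
# The lag-`T` inductance form is symmetric and positive, hence `B(a, b) ≥ −¼·B(b−a, b−a)`: the background DRIFT price of stub E1b
# (route `SoftLoopLongLag`, G-free)

WHAT.  The bilinear form `B_T(a, b) = Σ_{x,x' ∈ cube_R} a_x b_{x'} M(x, x'+Te₀; R)` of the free `ℤ⁴` mutual inductances of `R×R` squares over the
time-zero cube is
* SYMMETRIC (`sum_sum_mul_mul_mutualInductance_lag_symm`): `M(x', x+Te₀) = M(x, x'+Te₀)` for time-zero `x, x'` (time reflection `σ₀`, tree
  `mutualInductance_reflect`, symmetry `curvatureTwoPoint_comm`, stationarity — `mutualInductance_lag_swap`);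
* POSITIVE (`sum_sum_mul_mul_mutualInductance_lag_nonneg`, landed: reflection positivity of the free Maxwell field);
hence by polarisation around the midpoint `m = (a+b)/2`, `B(a,b) = B(m,m) − ¼B(b−a,b−a) ≥ −¼B(b−a,b−a)` (`sum_sum_mul_mul_mutualInductance_lag_ge`), and with
`Σ_{x,x'}|M| ≤ C·#cube²` (`T ≥ R`, landed `sum_sum_abs_mutualInductance_lag_le`): **`B_T(a,b) ≥ −(C/4)·#cube_R²·‖b − a‖_∞²`**
(`sum_sum_mul_mul_mutualInductance_lag_ge_of_abs_sub_le`).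

WHY (stub E1b, the LINEAR background term).  In the one-scale expansion around a crude-good datum the Gaussian covariance of the cube-smeared loop
observable carries `β·Σ_c B_R(Φ̄_c, Φ̄_c^{(R)})` with `Φ̄_c(x)` the background flux through the square at `x` at time `0` and `Φ̄_c^{(R)}(x')` the flux
through the square at `x'` at time `R` (tree `cov_gp_quad_pi_eq`).  The two weight functions differ by the background's time drift `|Φ̄^{(R)} − Φ̄| ≤ R·R²s/H`
(`s² ≍ β^{κ−1}`, width seat ym-line-sll-p4's `backgroundFlux_interior_bounds`), so this file prices the linear term at
`−β·(C/4)·(2R+1)⁶·R⁶s²/H² = −C'·R¹²β^κ/H²` WITHOUT any sign information on the background — the `C·R¹²·β^κ/⌈β^a⌉²` of the registered E1b.  A crude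
Cauchy–Schwarz bound (`|B(a, b−a)| ≤ ‖a‖‖b−a‖Σ|M| ≍ R¹¹s²/H`) would lose by `β^{κ+ε/4}` at `H = β^{31ε/4}`; positivity is what saves the day.

HONEST LABEL.  Free-field bookkeeping for a RECORD-label rung line (R2xi-G, leaf `WeakCouplingRates.XiPow` = an UPPER bound on the lattice mass gap,
all compact simple `G`); NOT the Clay mass gap; no summit statement is touched.

References: J. Fröhlich, R. Israel, E. Lieb, B. Simon, CMP 62 (1978) §3; C. Garban, A. Sepúlveda, IMRN 2023 §4.
-/

set_option autoImplicit false

noncomputable section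

open Finset
open Literature.Probability.LatticeModels (Site)
open Literature.MathematicalPhysics.QuantumLattice (ZdPlaquette)
open Literature.MathematicalPhysics.QuantumFieldTheory

namespace Summit.QuantumFields.YangMills.Theorems.SoftLoopLongLag

/-! ## Symmetry of the lag form -/

/-- The mutual inductance is symmetric: `M(x, y) = M(y, x)`. -/
theorem mutualInductance_comm (x y : Site 4) (R : ℕ) : mutualInductance x y R = mutualInductance y x R := by
  unfold mutualInductance
  rw [Finset.sum_comm]
  exact sum_congr rfl fun q _ => sum_congr rfl fun p _ => curvatureTwoPoint_comm p q

/-- Time reflection fixes a time-zero site. -/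
theorem reflectCoordZ_zero_of_apply_zero {x : Site 4} (hx : x 0 = 0) : reflectCoordZ 0 x = x := by
  ext j
  by_cases h : j = 0
  · subst h; rw [reflectCoordZ_apply_same, hx, neg_zero]
  · rw [reflectCoordZ_apply_ne h]

/-- **Lag swap**: for time-zero base points, `M(x', x + Te₀) = M(x, x' + Te₀)` (time reflection, symmetry, stationarity). -/
theorem mutualInductance_lag_swap {x x' : Site 4} (hx : x 0 = 0) (hx' : x' 0 = 0) (R T : ℕ) :
    mutualInductance x' (x + Pi.single 0 (T : ℤ)) R = mutualInductance x (x' + Pi.single 0 (T : ℤ)) R := by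
  -- time reflection: `M(x', x + Te₀) = M(x', x − Te₀)`
  have h1 := mutualInductance_reflect 0 x' (x + Pi.single 0 (T : ℤ)) R
  rw [reflectCoordZ_zero_of_apply_zero hx', reflectCoordZ_add, reflectCoordZ_zero_of_apply_zero hx, reflectCoordZ_single_same] at h1
  rw [← h1, mutualInductance_comm]
  -- stationarity: shift by `Te₀`
  have h2 := mutualInductance_shift (x + -Pi.single 0 (T : ℤ)) x' (Pi.single 0 (T : ℤ)) R
  rw [show x + -Pi.single 0 (T : ℤ) + Pi.single 0 (T : ℤ) = x by abel] at h2
  exact h2.symm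

/-- **The lag form is symmetric**: `Σ a_x b_{x'} M(x, x'+Te₀) = Σ b_x a_{x'} M(x, x'+Te₀)` over the time-zero cube. -/
theorem sum_sum_mul_mul_mutualInductance_lag_symm (R T : ℕ) (a b : Site 4 → ℝ) :
    ∑ x ∈ timeZeroCube R, ∑ x' ∈ timeZeroCube R, a x * b x' * mutualInductance x (x' + Pi.single 0 (T : ℤ)) R =
      ∑ x ∈ timeZeroCube R, ∑ x' ∈ timeZeroCube R, b x * a x' * mutualInductance x (x' + Pi.single 0 (T : ℤ)) R := by
  rw [Finset.sum_comm]
  refine sum_congr rfl fun x hx => sum_congr rfl fun x' hx' => ?_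
  have hx0 : x 0 = 0 := (mem_filter.1 hx).2
  have hx'0 : x' 0 = 0 := (mem_filter.1 hx').2
  rw [mutualInductance_lag_swap hx0 hx'0]
  ring

/-! ## Polarisation: `B(a,b) ≥ −¼ B(b−a, b−a)` -/

/-- **Polarisation bound**: since the lag form is symmetric and positive, `B(a,b) = B(m,m) − ¼B(δ,δ) ≥ −¼B(δ,δ)` with `m = (a+b)/2`, `δ = b − a`. -/
theorem sum_sum_mul_mul_mutualInductance_lag_ge (R T : ℕ) (a b : Site 4 → ℝ) :
    -(4⁻¹ * ∑ x ∈ timeZeroCube R, ∑ x' ∈ timeZeroCube R,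
        (b x - a x) * (b x' - a x') * mutualInductance x (x' + Pi.single 0 (T : ℤ)) R) ≤
      ∑ x ∈ timeZeroCube R, ∑ x' ∈ timeZeroCube R, a x * b x' * mutualInductance x (x' + Pi.single 0 (T : ℤ)) R := by
  set m : Site 4 → ℝ := fun x => (a x + b x) / 2 with hm
  set δ : Site 4 → ℝ := fun x => b x - a x with hδ
  have hpos := sum_sum_mul_mul_mutualInductance_lag_nonneg R T m
  have hsym := sum_sum_mul_mul_mutualInductance_lag_symm R T m δ
  -- termwise identity `a b' = m m' + ½ m δ' − ½ δ m' − ¼ δ δ'`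
  have hexp : ∑ x ∈ timeZeroCube R, ∑ x' ∈ timeZeroCube R, a x * b x' * mutualInductance x (x' + Pi.single 0 (T : ℤ)) R =
      (∑ x ∈ timeZeroCube R, ∑ x' ∈ timeZeroCube R, m x * m x' * mutualInductance x (x' + Pi.single 0 (T : ℤ)) R) +
        2⁻¹ * (∑ x ∈ timeZeroCube R, ∑ x' ∈ timeZeroCube R, m x * δ x' * mutualInductance x (x' + Pi.single 0 (T : ℤ)) R) -
        2⁻¹ * (∑ x ∈ timeZeroCube R, ∑ x' ∈ timeZeroCube R, δ x * m x' * mutualInductance x (x' + Pi.single 0 (T : ℤ)) R) -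
        4⁻¹ * (∑ x ∈ timeZeroCube R, ∑ x' ∈ timeZeroCube R, δ x * δ x' * mutualInductance x (x' + Pi.single 0 (T : ℤ)) R) := by
    rw [mul_sum, mul_sum, mul_sum, ← sum_add_distrib, ← sum_sub_distrib, ← sum_sub_distrib]
    refine sum_congr rfl fun x _ => ?_
    rw [mul_sum, mul_sum, mul_sum, ← sum_add_distrib, ← sum_sub_distrib, ← sum_sub_distrib]
    refine sum_congr rfl fun x' _ => ?_
    simp only [hm, hδ]
    ring
  rw [hexp, hsym]
  have hδδ : ∑ x ∈ timeZeroCube R, ∑ x' ∈ timeZeroCube R, (b x - a x) * (b x' - a x') * mutualInductance x (x' + Pi.single 0 (T : ℤ)) R =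
      ∑ x ∈ timeZeroCube R, ∑ x' ∈ timeZeroCube R, δ x * δ x' * mutualInductance x (x' + Pi.single 0 (T : ℤ)) R := by
    simp only [hδ]
  rw [hδδ]
  linarith

/-- **The drift price**: for `T ≥ R`, with the constant `C` of `sum_sum_abs_mutualInductance_lag_le`, if `|b_x − a_x| ≤ A` on the cube then
`B_T(a, b) ≥ −(C/4)·#cube_R²·A²`. -/
theorem sum_sum_mul_mul_mutualInductance_lag_ge_of_abs_sub_le :
    ∃ C : ℝ, 0 ≤ C ∧ ∀ (R T : ℕ), R ≤ T → ∀ (a b : Site 4 → ℝ) (A : ℝ), (∀ x ∈ timeZeroCube R, |b x - a x| ≤ A) →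
      -(C / 4 * ((timeZeroCube R).card : ℝ) ^ 2 * A ^ 2) ≤
        ∑ x ∈ timeZeroCube R, ∑ x' ∈ timeZeroCube R, a x * b x' * mutualInductance x (x' + Pi.single 0 (T : ℤ)) R := by
  obtain ⟨C, hC, hM⟩ := sum_sum_abs_mutualInductance_lag_le
  refine ⟨C, hC, fun R T hRT a b A hab => le_trans ?_ (sum_sum_mul_mul_mutualInductance_lag_ge R T a b)⟩
  -- a purely real step
  have key : ∀ {u v M : ℝ}, |u| ≤ A → |v| ≤ A → u * v * M ≤ A ^ 2 * |M| := by
    intro u v M hu hv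
    have hA0 : 0 ≤ A := (abs_nonneg _).trans hu
    have hprod : |u * v| ≤ A ^ 2 := by rw [abs_mul, sq]; exact mul_le_mul hu hv (abs_nonneg v) hA0
    calc u * v * M ≤ |u * v * M| := le_abs_self _
      _ = |u * v| * |M| := abs_mul _ _
      _ ≤ A ^ 2 * |M| := mul_le_mul_of_nonneg_right hprod (abs_nonneg M)
  have hsum := sum_le_sum fun x hx => sum_le_sum fun x' hx' => key
    (M := mutualInductance x (x' + Pi.single 0 (T : ℤ)) R) (hab x hx) (hab x' hx')
  have habs : ∑ x ∈ timeZeroCube R, ∑ x' ∈ timeZeroCube R, A ^ 2 * |mutualInductance x (x' + Pi.single 0 (T : ℤ)) R| =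
      A ^ 2 * ∑ x ∈ timeZeroCube R, ∑ x' ∈ timeZeroCube R, |mutualInductance x (x' + Pi.single 0 (T : ℤ)) R| := by
    rw [mul_sum]
    simp_rw [mul_sum]
  rw [habs] at hsum
  have hMb := mul_le_mul_of_nonneg_left (hM R T hRT) (sq_nonneg A)
  nlinarith [hsum, hMb]

end Summit.QuantumFields.YangMills.Theorems.SoftLoopLongLag

end
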